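import Mathlib
import Literature.Probability.LatticeModels.BesselIDebyeAsymptotics
import HarnessLib

/-!
# Crux `SelfNormalisedSkewness` (stmt-QuantumFields-18944, line `Sketch`): stub — Taylor reduction
of the cosine composite to Wick squares on the small box

For a probability measure `π` and real random variables `v p` with `|v p| < ε ≤ 1` a.e., the
block observable `F_S = ∑ p ∈ S, cos (v p)` over `|S| ≤ 6` indices decomposes as
`F_S = |S| - Q_S / 2 + ρ_S` with `Q_S = ∑ p ∈ S, (v p)²` and `0 ≤ ρ_S ≤ ε⁴ / 4` a.e.
(from `1 - x²/2 ≤ cos x ≤ 1 - x²/2 + x⁴/24`: Mathlib's `Real.one_sub_sq_div_two_le_cos` and the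
tree's `Literature.Probability.LatticeModels.cos_le_one_sub_sq_half_add_fourth`).  Centring
(a variable with values in `[0, M]` a.e. deviates from its mean by at most `M` a.e.) and expanding
the products pointwise, the centred third (resp. second) mixed moments of the `F`'s agree with
`-1/8` (resp. `+1/4`) times those of the `Q`'s up to `10 ε⁸` (resp. `10 ε⁶`); integrating the
a.e. pointwise bound over the probability measure gives the claim.
-/

noncomputable section

open scoped BigOperators
open MeasureTheory

namespace Summit.QuantumFields.YangMills.Theorems.SelfNormalisedSkewness.Negative

/-! ### Pointwise real-variable bookkeeping -/

/-- Pointwise cubic Taylor bookkeeping: if `|q·| ≤ 6 ε²` and `|r·| ≤ ε⁴ / 4` with `0 < ε ≤ 1`, then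
`(-q_a/2 + r_a)(-q_b/2 + r_b)(-q_d/2 + r_d) + q_a q_b q_d / 8` is at most `10 ε⁸` in absolute
value. [folklore] -/
theorem boxTaylor_alg_triple {ε qa qb qd ra rb rd : ℝ} (hε0 : 0 < ε) (hε1 : ε ≤ 1)
    (hqa : |qa| ≤ 6 * ε ^ 2) (hqb : |qb| ≤ 6 * ε ^ 2) (hqd : |qd| ≤ 6 * ε ^ 2)
    (hra : |ra| ≤ ε ^ 4 / 4) (hrb : |rb| ≤ ε ^ 4 / 4) (hrd : |rd| ≤ ε ^ 4 / 4) :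
    |(-(1 / 2 : ℝ) * qa + ra) * (-(1 / 2 : ℝ) * qb + rb) * (-(1 / 2 : ℝ) * qd + rd) +
        (1 / 8 : ℝ) * (qa * qb * qd)| ≤ 10 * ε ^ 8 := by
  -- `|x y z| ≤ X Y Z` termwise (two applications of `abs_mul` and `mul_le_mul`)
  have hmul : ∀ {x y z X Y Z : ℝ}, |x| ≤ X → |y| ≤ Y → |z| ≤ Z → |x * y * z| ≤ X * Y * Z := by
    intro x y z X Y Z hx hy hz
    have hX : 0 ≤ X := (abs_nonneg x).trans hx
    rw [abs_mul, abs_mul]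
    exact mul_le_mul (mul_le_mul hx hy (abs_nonneg _) hX) hz (abs_nonneg _)
      (mul_nonneg hX ((abs_nonneg y).trans hy))
  have h1 := abs_le.1 (hmul hqa hqb hrd)
  have h2 := abs_le.1 (hmul hqa hrb hqd)
  have h3 := abs_le.1 (hmul hra hqb hqd)
  have h4 := abs_le.1 (hmul hqa hrb hrd)
  have h5 := abs_le.1 (hmul hra hqb hrd)
  have h6 := abs_le.1 (hmul hra hrb hqd)
  have h7 := abs_le.1 (hmul hra hrb hrd)
  have hε8 : 0 ≤ ε ^ 8 := pow_nonneg hε0.le 8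
  have hε10 : ε ^ 10 ≤ ε ^ 8 := pow_le_pow_of_le_one hε0.le hε1 (by norm_num)
  have hε12 : ε ^ 12 ≤ ε ^ 8 := pow_le_pow_of_le_one hε0.le hε1 (by norm_num)
  have key : (-(1 / 2 : ℝ) * qa + ra) * (-(1 / 2 : ℝ) * qb + rb) * (-(1 / 2 : ℝ) * qd + rd) +
        (1 / 8 : ℝ) * (qa * qb * qd) =
      (1 / 4 : ℝ) * (qa * qb * rd) + (1 / 4 : ℝ) * (qa * rb * qd) + (1 / 4 : ℝ) * (ra * qb * qd)
        - (1 / 2 : ℝ) * (qa * rb * rd) - (1 / 2 : ℝ) * (ra * qb * rd)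
        - (1 / 2 : ℝ) * (ra * rb * qd) + ra * rb * rd := by
    ring
  rw [key, abs_le]
  obtain ⟨h1l, h1u⟩ := h1
  obtain ⟨h2l, h2u⟩ := h2
  obtain ⟨h3l, h3u⟩ := h3
  obtain ⟨h4l, h4u⟩ := h4
  obtain ⟨h5l, h5u⟩ := h5
  obtain ⟨h6l, h6u⟩ := h6
  obtain ⟨h7l, h7u⟩ := h7
  constructor <;> linarith

/-- Pointwise quadratic Taylor bookkeeping: if `|q·| ≤ 6 ε²` and `|r·| ≤ ε⁴ / 4` with `0 < ε ≤ 1`,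
then `(-q_a/2 + r_a)(-q_b/2 + r_b) - q_a q_b / 4` is at most `10 ε⁶` in absolute value.
[folklore] -/
theorem boxTaylor_alg_pair {ε qa qb ra rb : ℝ} (hε0 : 0 < ε) (hε1 : ε ≤ 1)
    (hqa : |qa| ≤ 6 * ε ^ 2) (hqb : |qb| ≤ 6 * ε ^ 2)
    (hra : |ra| ≤ ε ^ 4 / 4) (hrb : |rb| ≤ ε ^ 4 / 4) :
    |(-(1 / 2 : ℝ) * qa + ra) * (-(1 / 2 : ℝ) * qb + rb) - (1 / 4 : ℝ) * (qa * qb)| ≤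
      10 * ε ^ 6 := by
  -- `|x y| ≤ X Y` termwise (`abs_mul` and `mul_le_mul`)
  have hmul : ∀ {x y X Y : ℝ}, |x| ≤ X → |y| ≤ Y → |x * y| ≤ X * Y := by
    intro x y X Y hx hy
    rw [abs_mul]
    exact mul_le_mul hx hy (abs_nonneg _) ((abs_nonneg x).trans hx)
  have h1 := abs_le.1 (hmul hqa hrb)
  have h2 := abs_le.1 (hmul hra hqb)
  have h3 := abs_le.1 (hmul hra hrb)
  have hε6 : 0 ≤ ε ^ 6 := pow_nonneg hε0.le 6
  have hε8 : ε ^ 8 ≤ ε ^ 6 := pow_le_pow_of_le_one hε0.le hε1 (by norm_num)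
  have key : (-(1 / 2 : ℝ) * qa + ra) * (-(1 / 2 : ℝ) * qb + rb) - (1 / 4 : ℝ) * (qa * qb) =
      -(1 / 2 : ℝ) * (qa * rb) - (1 / 2 : ℝ) * (ra * qb) + ra * rb := by
    ring
  rw [key, abs_le]
  obtain ⟨h1l, h1u⟩ := h1
  obtain ⟨h2l, h2u⟩ := h2
  obtain ⟨h3l, h3u⟩ := h3
  constructor <;> linarith

/-! ### Centring and one block -/

/-- A real random variable with values in `[0, M]` a.e. under a probability measure deviates from
its mean by at most `M` a.e. [folklore] -/
theorem boxTaylor_ae_abs_sub_integral_le {Ω : Type} [MeasurableSpace Ω] {π : Measure Ω}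
    [IsProbabilityMeasure π] {X : Ω → ℝ} {M : ℝ} (hM : 0 ≤ M)
    (h : ∀ᵐ ω ∂π, 0 ≤ X ω ∧ X ω ≤ M) :
    ∀ᵐ ω ∂π, |X ω - ∫ ω', X ω' ∂π| ≤ M := by
  have h0 : 0 ≤ ∫ ω', X ω' ∂π := integral_nonneg_of_ae (h.mono fun ω hω => hω.1)
  have h1 : ∫ ω', X ω' ∂π ≤ M := by
    by_cases hX : Integrable X π
    · calc ∫ ω', X ω' ∂π ≤ ∫ _, M ∂π :=
            integral_mono_ae hX (integrable_const M) (h.mono fun ω hω => hω.2)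
        _ = M := by simp
    · rw [integral_undef hX]
      exact hM
  filter_upwards [h] with ω hω
  rw [abs_le]
  constructor <;> linarith [hω.1, hω.2]

/-- One block `S` (`|S| ≤ 6`) on the box `|v p| < ε` a.e.: the centred `∑ cos (v p)` equals
`-1/2` times the centred `∑ (v p)²` plus a remainder bounded by `ε⁴ / 4` a.e., and the centred
`∑ (v p)²` is bounded by `6 ε²` a.e. [folklore] -/
theorem boxTaylor_block {Ω : Type} [MeasurableSpace Ω] (π : Measure Ω) [IsProbabilityMeasure π]
    {P : Type} (v : P → Ω → ℝ) (hv : ∀ p, Measurable (v p)) {ε : ℝ}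
    (hsmall : ∀ p, ∀ᵐ ω ∂π, |v p ω| < ε) (S : Finset P) (hS : S.card ≤ 6) :
    ∃ r : Ω → ℝ,
      (∀ ω, (∑ p ∈ S, Real.cos (v p ω)) - ∫ ω', (∑ p ∈ S, Real.cos (v p ω')) ∂π =
          -(1 / 2 : ℝ) * ((∑ p ∈ S, v p ω ^ 2) - ∫ ω', (∑ p ∈ S, v p ω' ^ 2) ∂π) + r ω) ∧
      (∀ᵐ ω ∂π, |(∑ p ∈ S, v p ω ^ 2) - ∫ ω', (∑ p ∈ S, v p ω' ^ 2) ∂π| ≤ 6 * ε ^ 2) ∧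
      (∀ᵐ ω ∂π, |r ω| ≤ ε ^ 4 / 4) := by
  have hsm : ∀ᵐ ω ∂π, ∀ p ∈ S, |v p ω| < ε := (Finset.eventually_all S).2 fun p _ => hsmall p
  have hS' : (S.card : ℝ) ≤ 6 := by exact_mod_cast hS
  have hc_meas : Measurable fun ω => ∑ p ∈ S, Real.cos (v p ω) :=
    Finset.measurable_sum S fun p _ => (hv p).cos
  have hq_meas : Measurable fun ω => ∑ p ∈ S, v p ω ^ 2 :=
    Finset.measurable_sum S fun p _ => (hv p).pow_const 2
  -- a.e. bounds on the sum of squares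
  have hq_bd : ∀ᵐ ω ∂π, 0 ≤ (∑ p ∈ S, v p ω ^ 2) ∧ (∑ p ∈ S, v p ω ^ 2) ≤ 6 * ε ^ 2 := by
    filter_upwards [hsm] with ω hω
    refine ⟨Finset.sum_nonneg fun p _ => sq_nonneg _, ?_⟩
    calc (∑ p ∈ S, v p ω ^ 2) ≤ ∑ _p ∈ S, ε ^ 2 := Finset.sum_le_sum fun p hp => by
            have h := pow_le_pow_left₀ (abs_nonneg _) (hω p hp).le 2
            rwa [sq_abs] at h
      _ = S.card * ε ^ 2 := by rw [Finset.sum_const, nsmul_eq_mul]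
      _ ≤ 6 * ε ^ 2 := mul_le_mul_of_nonneg_right hS' (sq_nonneg ε)
  -- a.e. bounds on the Taylor remainder `∑ (cos (v p) - 1 + (v p)² / 2)`
  have hρ_bd : ∀ᵐ ω ∂π,
      0 ≤ (∑ p ∈ S, Real.cos (v p ω)) - S.card + (1 / 2 : ℝ) * ∑ p ∈ S, v p ω ^ 2 ∧
      (∑ p ∈ S, Real.cos (v p ω)) - S.card + (1 / 2 : ℝ) * ∑ p ∈ S, v p ω ^ 2 ≤ ε ^ 4 / 4 := by
    filter_upwards [hsm] with ω hω
    have hsum : (∑ p ∈ S, Real.cos (v p ω)) - S.card + (1 / 2 : ℝ) * ∑ p ∈ S, v p ω ^ 2 =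
        ∑ p ∈ S, (Real.cos (v p ω) - 1 + (1 / 2 : ℝ) * v p ω ^ 2) := by
      simp only [Finset.sum_add_distrib, Finset.sum_sub_distrib, Finset.sum_const, nsmul_eq_mul,
        mul_one, Finset.mul_sum]
    have hterm : ∀ p ∈ S, 0 ≤ Real.cos (v p ω) - 1 + (1 / 2 : ℝ) * v p ω ^ 2 ∧
        Real.cos (v p ω) - 1 + (1 / 2 : ℝ) * v p ω ^ 2 ≤ ε ^ 4 / 24 := by
      intro p hp
      have h1 := Real.one_sub_sq_div_two_le_cos (x := v p ω)
      have h2 := Literature.Probability.LatticeModels.cos_le_one_sub_sq_half_add_fourth (v p ω)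
      have h3 : v p ω ^ 4 ≤ ε ^ 4 := by
        have h := pow_le_pow_left₀ (abs_nonneg _) (hω p hp).le 4
        rwa [Even.pow_abs ⟨2, rfl⟩] at h
      constructor <;> linarith
    rw [hsum]
    refine ⟨Finset.sum_nonneg fun p hp => (hterm p hp).1, ?_⟩
    calc ∑ p ∈ S, (Real.cos (v p ω) - 1 + (1 / 2 : ℝ) * v p ω ^ 2)
          ≤ ∑ _p ∈ S, ε ^ 4 / 24 := Finset.sum_le_sum fun p hp => (hterm p hp).2
      _ = S.card * (ε ^ 4 / 24) := by rw [Finset.sum_const, nsmul_eq_mul]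
      _ ≤ 6 * (ε ^ 4 / 24) := mul_le_mul_of_nonneg_right hS' (by positivity)
      _ = ε ^ 4 / 4 := by ring
  -- integrability of the two sums
  have hc_int : Integrable (fun ω => ∑ p ∈ S, Real.cos (v p ω)) π := by
    refine Integrable.of_bound hc_meas.aestronglyMeasurable S.card (ae_of_all _ fun ω => ?_)
    calc ‖∑ p ∈ S, Real.cos (v p ω)‖ ≤ ∑ p ∈ S, ‖Real.cos (v p ω)‖ := norm_sum_le _ _
      _ ≤ ∑ _p ∈ S, (1 : ℝ) := Finset.sum_le_sum fun p _ => by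
          rw [Real.norm_eq_abs]
          exact Real.abs_cos_le_one _
      _ = S.card := by rw [Finset.sum_const, nsmul_eq_mul, mul_one]
  have hq_int : Integrable (fun ω => ∑ p ∈ S, v p ω ^ 2) π :=
    Integrable.of_bound hq_meas.aestronglyMeasurable (6 * ε ^ 2)
      (hq_bd.mono fun ω hω => by rw [Real.norm_eq_abs, abs_of_nonneg hω.1]; exact hω.2)
  -- the mean of the remainder
  have hρ_int : ∫ ω, ((∑ p ∈ S, Real.cos (v p ω)) - S.card + (1 / 2 : ℝ) * ∑ p ∈ S, v p ω ^ 2) ∂π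
      = (∫ ω, (∑ p ∈ S, Real.cos (v p ω)) ∂π) - S.card +
          (1 / 2 : ℝ) * ∫ ω, (∑ p ∈ S, v p ω ^ 2) ∂π := by
    have i1 : Integrable (fun ω => (∑ p ∈ S, Real.cos (v p ω)) - (S.card : ℝ)) π :=
      hc_int.sub (integrable_const _)
    have i2 : Integrable (fun ω => (1 / 2 : ℝ) * ∑ p ∈ S, v p ω ^ 2) π := hq_int.const_mul _
    rw [integral_add i1 i2, integral_sub hc_int (integrable_const _), integral_const,
      integral_const_mul, probReal_univ, one_smul]
  -- assemble: the remainder is the centred Taylor remainder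
  have hid : ∀ ω, (∑ p ∈ S, Real.cos (v p ω)) - ∫ ω', (∑ p ∈ S, Real.cos (v p ω')) ∂π =
      -(1 / 2 : ℝ) * ((∑ p ∈ S, v p ω ^ 2) - ∫ ω', (∑ p ∈ S, v p ω' ^ 2) ∂π) +
        (((∑ p ∈ S, Real.cos (v p ω)) - S.card + (1 / 2 : ℝ) * ∑ p ∈ S, v p ω ^ 2) -
          ∫ ω', ((∑ p ∈ S, Real.cos (v p ω')) - S.card +
            (1 / 2 : ℝ) * ∑ p ∈ S, v p ω' ^ 2) ∂π) := by
    intro ω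
    rw [hρ_int]
    ring
  exact ⟨_, hid, boxTaylor_ae_abs_sub_integral_le (by positivity) hq_bd,
    boxTaylor_ae_abs_sub_integral_le (by positivity) hρ_bd⟩

/-! ### Integrating the pointwise comparison -/

/-- Integrated cubic comparison: if `f_X = -g_X/2 + r_X` pointwise with `|g_X| ≤ 6 ε²` and
`|r_X| ≤ ε⁴/4` a.e. (`X = A, B, D`), all measurable, then
`|∫ f_A f_B f_D + (1/8) ∫ g_A g_B g_D| ≤ 10 ε⁸`. [folklore] -/
theorem boxTaylor_triple_bound {Ω : Type} [MeasurableSpace Ω] (π : Measure Ω)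
    [IsProbabilityMeasure π] {ε : ℝ} (hε0 : 0 < ε) (hε1 : ε ≤ 1) {fA fB fD gA gB gD : Ω → ℝ}
    (rA rB rD : Ω → ℝ)
    (hfA : Measurable fA) (hfB : Measurable fB) (hfD : Measurable fD)
    (hgA : Measurable gA) (hgB : Measurable gB) (hgD : Measurable gD)
    (eA : ∀ ω, fA ω = -(1 / 2 : ℝ) * gA ω + rA ω) (eB : ∀ ω, fB ω = -(1 / 2 : ℝ) * gB ω + rB ω)
    (eD : ∀ ω, fD ω = -(1 / 2 : ℝ) * gD ω + rD ω)
    (bgA : ∀ᵐ ω ∂π, |gA ω| ≤ 6 * ε ^ 2) (bgB : ∀ᵐ ω ∂π, |gB ω| ≤ 6 * ε ^ 2)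
    (bgD : ∀ᵐ ω ∂π, |gD ω| ≤ 6 * ε ^ 2)
    (brA : ∀ᵐ ω ∂π, |rA ω| ≤ ε ^ 4 / 4) (brB : ∀ᵐ ω ∂π, |rB ω| ≤ ε ^ 4 / 4)
    (brD : ∀ᵐ ω ∂π, |rD ω| ≤ ε ^ 4 / 4) :
    |(∫ ω, fA ω * fB ω * fD ω ∂π) + (1 / 8 : ℝ) * ∫ ω, gA ω * gB ω * gD ω ∂π| ≤ 10 * ε ^ 8 := by
  -- a.e. pointwise bound
  have hpt : ∀ᵐ ω ∂π, |fA ω * fB ω * fD ω + (1 / 8 : ℝ) * (gA ω * gB ω * gD ω)| ≤ 10 * ε ^ 8 := by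
    filter_upwards [bgA, bgB, bgD, brA, brB, brD] with ω h1 h2 h3 h4 h5 h6
    rw [eA ω, eB ω, eD ω]
    exact boxTaylor_alg_triple hε0 hε1 h1 h2 h3 h4 h5 h6
  have hG : ∀ᵐ ω ∂π, |gA ω * gB ω * gD ω| ≤ 6 * ε ^ 2 * (6 * ε ^ 2) * (6 * ε ^ 2) := by
    filter_upwards [bgA, bgB, bgD] with ω h1 h2 h3
    rw [abs_mul, abs_mul]
    exact mul_le_mul (mul_le_mul h1 h2 (abs_nonneg _) (by positivity)) h3 (abs_nonneg _)
      (by positivity)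
  -- integrability
  have hG_int : Integrable (fun ω => gA ω * gB ω * gD ω) π :=
    Integrable.of_bound ((hgA.mul hgB).mul hgD).aestronglyMeasurable _
      (hG.mono fun ω hω => by rw [Real.norm_eq_abs]; exact hω)
  have hF_int : Integrable (fun ω => fA ω * fB ω * fD ω) π := by
    refine Integrable.of_bound ((hfA.mul hfB).mul hfD).aestronglyMeasurable
      (10 * ε ^ 8 + (1 / 8 : ℝ) * (6 * ε ^ 2 * (6 * ε ^ 2) * (6 * ε ^ 2))) ?_
    filter_upwards [hpt, hG] with ω h1 h2
    rw [Real.norm_eq_abs, abs_le]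
    obtain ⟨h1l, h1u⟩ := abs_le.1 h1
    obtain ⟨h2l, h2u⟩ := abs_le.1 h2
    constructor <;> linarith
  -- integrate
  have hsum : (∫ ω, fA ω * fB ω * fD ω ∂π) + (1 / 8 : ℝ) * ∫ ω, gA ω * gB ω * gD ω ∂π =
      ∫ ω, (fA ω * fB ω * fD ω + (1 / 8 : ℝ) * (gA ω * gB ω * gD ω)) ∂π := by
    rw [integral_add hF_int (hG_int.const_mul _), integral_const_mul]
  have hpt' : ∀ᵐ ω ∂π, ‖fA ω * fB ω * fD ω + (1 / 8 : ℝ) * (gA ω * gB ω * gD ω)‖ ≤ 10 * ε ^ 8 :=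
    hpt.mono fun ω hω => by rw [Real.norm_eq_abs]; exact hω
  have h := norm_integral_le_of_norm_le_const hpt'
  rw [probReal_univ, mul_one, Real.norm_eq_abs] at h
  rw [hsum]
  exact h

/-- Integrated quadratic comparison: if `f_X = -g_X/2 + r_X` pointwise with `|g_X| ≤ 6 ε²` and
`|r_X| ≤ ε⁴/4` a.e. (`X = A, B`), all measurable, then `|∫ f_A f_B - (1/4) ∫ g_A g_B| ≤ 10 ε⁶`.
[folklore] -/
theorem boxTaylor_pair_bound {Ω : Type} [MeasurableSpace Ω] (π : Measure Ω) [IsProbabilityMeasure π]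
    {ε : ℝ} (hε0 : 0 < ε) (hε1 : ε ≤ 1) {fA fB gA gB : Ω → ℝ} (rA rB : Ω → ℝ)
    (hfA : Measurable fA) (hfB : Measurable fB) (hgA : Measurable gA) (hgB : Measurable gB)
    (eA : ∀ ω, fA ω = -(1 / 2 : ℝ) * gA ω + rA ω) (eB : ∀ ω, fB ω = -(1 / 2 : ℝ) * gB ω + rB ω)
    (bgA : ∀ᵐ ω ∂π, |gA ω| ≤ 6 * ε ^ 2) (bgB : ∀ᵐ ω ∂π, |gB ω| ≤ 6 * ε ^ 2)
    (brA : ∀ᵐ ω ∂π, |rA ω| ≤ ε ^ 4 / 4) (brB : ∀ᵐ ω ∂π, |rB ω| ≤ ε ^ 4 / 4) :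
    |(∫ ω, fA ω * fB ω ∂π) - (1 / 4 : ℝ) * ∫ ω, gA ω * gB ω ∂π| ≤ 10 * ε ^ 6 := by
  have hpt : ∀ᵐ ω ∂π, |fA ω * fB ω - (1 / 4 : ℝ) * (gA ω * gB ω)| ≤ 10 * ε ^ 6 := by
    filter_upwards [bgA, bgB, brA, brB] with ω h1 h2 h3 h4
    rw [eA ω, eB ω]
    exact boxTaylor_alg_pair hε0 hε1 h1 h2 h3 h4
  have hG : ∀ᵐ ω ∂π, |gA ω * gB ω| ≤ 6 * ε ^ 2 * (6 * ε ^ 2) := by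
    filter_upwards [bgA, bgB] with ω h1 h2
    rw [abs_mul]
    exact mul_le_mul h1 h2 (abs_nonneg _) (by positivity)
  have hG_int : Integrable (fun ω => gA ω * gB ω) π :=
    Integrable.of_bound (hgA.mul hgB).aestronglyMeasurable _
      (hG.mono fun ω hω => by rw [Real.norm_eq_abs]; exact hω)
  have hF_int : Integrable (fun ω => fA ω * fB ω) π := by
    refine Integrable.of_bound (hfA.mul hfB).aestronglyMeasurable
      (10 * ε ^ 6 + (1 / 4 : ℝ) * (6 * ε ^ 2 * (6 * ε ^ 2))) ?_
    filter_upwards [hpt, hG] with ω h1 h2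
    rw [Real.norm_eq_abs, abs_le]
    obtain ⟨h1l, h1u⟩ := abs_le.1 h1
    obtain ⟨h2l, h2u⟩ := abs_le.1 h2
    constructor <;> linarith
  have hsum : (∫ ω, fA ω * fB ω ∂π) - (1 / 4 : ℝ) * ∫ ω, gA ω * gB ω ∂π =
      ∫ ω, (fA ω * fB ω - (1 / 4 : ℝ) * (gA ω * gB ω)) ∂π := by
    rw [integral_sub hF_int (hG_int.const_mul _), integral_const_mul]
  have hpt' : ∀ᵐ ω ∂π, ‖fA ω * fB ω - (1 / 4 : ℝ) * (gA ω * gB ω)‖ ≤ 10 * ε ^ 6 :=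
    hpt.mono fun ω hω => by rw [Real.norm_eq_abs]; exact hω
  have h := norm_integral_le_of_norm_le_const hpt'
  rw [probReal_univ, mul_one, Real.norm_eq_abs] at h
  rw [hsum]
  exact h

/-! ### The stub -/

/-- Wave-3 stub: Taylor reduction of the cosine composite to Wick squares on the small box
(central moments).  For a probability measure `π`, measurable `v p` with `|v p| < ε ≤ 1` a.e.
and index blocks `A, B, D` of size `≤ 6`, the centred third mixed moment of the
`∑ cos (v p)`'s is `-1/8` times that of the `∑ (v p)²`'s up to `10 ε⁸`, and the centred second
mixed moment is `1/4` times that of the squares up to `10 ε⁶`. [folklore] -/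
theorem stub_boxTaylorCumulants {Ω : Type} [MeasurableSpace Ω] (π : Measure Ω) [IsProbabilityMeasure π]
    {P : Type} (v : P → Ω → ℝ) (hv : ∀ p, Measurable (v p)) {ε : ℝ} (hε0 : 0 < ε) (hε1 : ε ≤ 1)
    (hsmall : ∀ p, ∀ᵐ ω ∂π, |v p ω| < ε) (A B D : Finset P) (hA : A.card ≤ 6) (hB : B.card ≤ 6)
    (hD : D.card ≤ 6) :
    |(∫ ω, ((∑ p ∈ A, Real.cos (v p ω)) - ∫ ω', (∑ p ∈ A, Real.cos (v p ω')) ∂π) *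
          ((∑ p ∈ B, Real.cos (v p ω)) - ∫ ω', (∑ p ∈ B, Real.cos (v p ω')) ∂π) *
          ((∑ p ∈ D, Real.cos (v p ω)) - ∫ ω', (∑ p ∈ D, Real.cos (v p ω')) ∂π) ∂π) +
        (1 / 8 : ℝ) * ∫ ω, ((∑ p ∈ A, v p ω ^ 2) - ∫ ω', (∑ p ∈ A, v p ω' ^ 2) ∂π) *
          ((∑ p ∈ B, v p ω ^ 2) - ∫ ω', (∑ p ∈ B, v p ω' ^ 2) ∂π) *
          ((∑ p ∈ D, v p ω ^ 2) - ∫ ω', (∑ p ∈ D, v p ω' ^ 2) ∂π) ∂π| ≤ 10 * ε ^ 8 ∧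
    |(∫ ω, ((∑ p ∈ A, Real.cos (v p ω)) - ∫ ω', (∑ p ∈ A, Real.cos (v p ω')) ∂π) *
          ((∑ p ∈ B, Real.cos (v p ω)) - ∫ ω', (∑ p ∈ B, Real.cos (v p ω')) ∂π) ∂π) -
        (1 / 4 : ℝ) * ∫ ω, ((∑ p ∈ A, v p ω ^ 2) - ∫ ω', (∑ p ∈ A, v p ω' ^ 2) ∂π) *
          ((∑ p ∈ B, v p ω ^ 2) - ∫ ω', (∑ p ∈ B, v p ω' ^ 2) ∂π) ∂π| ≤ 10 * ε ^ 6 := by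
  obtain ⟨rA, hAe, hAq, hAr⟩ := boxTaylor_block π v hv hsmall A hA
  obtain ⟨rB, hBe, hBq, hBr⟩ := boxTaylor_block π v hv hsmall B hB
  obtain ⟨rD, hDe, hDq, hDr⟩ := boxTaylor_block π v hv hsmall D hD
  have mc : ∀ S : Finset P, Measurable fun ω =>
      (∑ p ∈ S, Real.cos (v p ω)) - ∫ ω', (∑ p ∈ S, Real.cos (v p ω')) ∂π :=
    fun S => (Finset.measurable_sum S fun p _ => (hv p).cos).sub_const _
  have mq : ∀ S : Finset P, Measurable fun ω =>
      (∑ p ∈ S, v p ω ^ 2) - ∫ ω', (∑ p ∈ S, v p ω' ^ 2) ∂π :=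
    fun S => (Finset.measurable_sum S fun p _ => (hv p).pow_const 2).sub_const _
  exact ⟨boxTaylor_triple_bound π hε0 hε1 rA rB rD (mc A) (mc B) (mc D) (mq A) (mq B) (mq D)
      hAe hBe hDe hAq hBq hDq hAr hBr hDr,
    boxTaylor_pair_bound π hε0 hε1 rA rB (mc A) (mc B) (mq A) (mq B) hAe hBe hAq hBq hAr hBr⟩

end Summit.QuantumFields.YangMills.Theorems.SelfNormalisedSkewness.Negative

end
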